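import Mathlib
import HarnessLib
import Literature.Analysis.FluidPDE.ClassicalLocalEnergyCutoff
import Literature.Analysis.FluidPDE.MildSolutionProofs

/-!
# Route `PoloidalWindowDoor`, crux `PoloidalWindowRigidity` (K2, stmt-NavierStokesRegularity-19708) — whole-class tool:
# slice estimates for the LARGE-SCALE ENERGY DECAY of Type-I slices (tools file; the decay theorem is the companion
# `…LargeScaleEnergyDecay`)

Cell ns-regularity-ideate, seat nsreg-p7 gen 5 (third worker; file landed `--supports stmt-NavierStokesRegularity-19708`
as a helper; the K2 lead's «TYPER/PROVER TASK (whole-programme value)», STATUS 2026-08-27T02:10:48Z, K2P1-M11-NOTES §5).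

For a classical solution `(u, p)` of the unforced unit-viscosity Navier–Stokes system on an open time set `S` and the
cut-off `φ = cutoff R` (`= 1` on `B̄(0,R)`, `= 0` off `B(0,2R)`, `‖Dφ‖ ≤ C₁/R`, `|Δφ| ≤ C₂/R²`):

* `tsupport_cutoff_subset`, `isTestFunctionOn_cutoff`, `integral_fderiv_cutoff_apply_eq_zero` (`∫ Dφ(x)(w x) dx = 0`
  for a `C¹` divergence-free `w`: the pressure constant drops out of the flux);
* `flux_le` — the SLICE FLUX BOUND under `‖u(s,·)‖ ≤ C/√(−s)` and the mean-oscillation hypothesis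
  `∃ c, ∫_{B̄(0,2R)}|p(s) − c| ≤ (A/(−s))|B̄(0,2R)|` (the shape of (F1), CZ `L∞ → BMO`; kept as a hypothesis):
  `∫ (Δφ|u|² + Dφ(u)|u|² + 2pDφ(u)) ≤ |B̄(0,2R)|·(C₂/R²·M² + C₁/R·M³ + 2(C₁/R)M·A/(−s))`, `M = C/√(−s)`;
* `integral_cutoff_norm_sq_le` (`∫φ|w|² ≤ |B̄(0,2R)| B²` if `‖w‖ ≤ B`), `setIntegral_ball_le_integral_cutoff`
  (`∫_{B(0,R)}|w|² ≤ ∫φ|w|²`);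
* `intervalIntegral_inv_neg` (`∫_{t₁}^{t₂} ds/(−s) = log(t₁/t₂)`), `intervalIntegral_inv_neg_sqrt_le`
  (`∫_{t₁}^{t₂} ds/((−s)√(−s)) ≤ 2/√(−t₂)`).

WHAT THIS IS NOT: not a claim about Navier–Stokes regularity — calculus/measure bookkeeping (bears_on LADDER-NS N0).
-/

noncomputable section

-- the summit and its single sub-problem share the name (CONVENTIONS §1), as in every Theorems file
set_option linter.dupNamespace false

namespace Summit.NavierStokesRegularity.NavierStokesRegularity.Theorems.PoloidalWindowDoorPoloidalWindowRigidityLargeScaleEnergyDecayTools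

open MeasureTheory Set Function Filter Topology TopologicalSpace Metric InnerProductSpace
open scoped RealInnerProductSpace InnerProductSpace Laplacian ContDiff
open Literature.Analysis Literature.Analysis.FluidPDE

variable {S : Set ℝ} {u : ℝ → EuclideanSpace ℝ (Fin 3) → EuclideanSpace ℝ (Fin 3)}
  {p : ℝ → EuclideanSpace ℝ (Fin 3) → ℝ}

/-! ### The cut-off: support and test-function property -/

/-- The cut-off `cutoff R` is supported in the closed ball `B̄(0, 2R)`. [folklore] -/
theorem tsupport_cutoff_subset {R : ℝ} (hR : 0 < R) :
    tsupport (cutoff (E := EuclideanSpace ℝ (Fin 3)) R) ⊆ closedBall 0 (2 * R) := by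
  refine closure_minimal (fun x hx => ?_) isClosed_closedBall
  rw [mem_closedBall, dist_zero_right]
  by_contra h
  push Not at h
  exact hx (cutoff_eq_zero hR h.le)

/-- `cutoff R` is a test function on the whole space. [folklore] -/
theorem isTestFunctionOn_cutoff {R : ℝ} (hR : 0 < R) :
    FunctionSpaces.IsTestFunctionOn (⊤ : Opens (EuclideanSpace ℝ (Fin 3)))
      (cutoff (E := EuclideanSpace ℝ (Fin 3)) R) :=
  ⟨contDiff_cutoff (n := ⊤) R, hasCompactSupport_cutoff hR, fun _ _ => trivial⟩

/-- **The pressure constant drops out**: for a `C¹` divergence-free slice `w` and the cut-off `φ = cutoff R`,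
`∫ Dφ(x)(w x) dx = 0` (`Dφ(x)(w x) = ⟪w x, ∇φ(x)⟫`, Gauss–Green). [folklore] -/
theorem integral_fderiv_cutoff_apply_eq_zero {w : EuclideanSpace ℝ (Fin 3) → EuclideanSpace ℝ (Fin 3)}
    (hw : VectorCalculus.IsDivFree w) (hw1 : ContDiff ℝ 1 w) {R : ℝ} (hR : 0 < R) :
    ∫ x, fderiv ℝ (cutoff (E := EuclideanSpace ℝ (Fin 3)) R) x (w x) = 0 := by
  have h := VectorCalculus.IsDivFree.isWeaklyDivFree_holds hw hw1 _ (isTestFunctionOn_cutoff hR)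
  have e : (fun x => ⟪w x, gradient (cutoff (E := EuclideanSpace ℝ (Fin 3)) R) x⟫_ℝ) =
      fun x => fderiv ℝ (cutoff (E := EuclideanSpace ℝ (Fin 3)) R) x (w x) := by
    funext x
    rw [real_inner_comm, gradient, InnerProductSpace.toDual_symm_apply]
  rw [← e]; exact h

/-! ### The slice flux bound -/

/-- **Slice bound of the cut-off energy flux.**  At a time `s ∈ S`, `s < 0`, with `‖u(s,·)‖ ≤ C/√(−s)` and the
mean-oscillation bound `∫_{B̄(0,2R)} |p(s) − c| ≤ (A/(−s))|B̄(0,2R)|` for some constant `c`, the flux of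
`local_energy_identity_cutoff` (viscosity `1`, `φ = cutoff R` with `‖Dφ‖ ≤ C₁/R`, `|Δφ| ≤ C₂/R²`) satisfies
`∫ (Δφ|u|² + Dφ(u)|u|² + 2 p Dφ(u)) ≤ |B̄(0,2R)| · (C₂/R² · M² + C₁/R · M³ + 2(C₁/R) M · A/(−s))`, `M = C/√(−s)`. -/
theorem flux_le (h : IsClassicalNSSolutionOn S 1 0 u p) {s : ℝ} (hs : s ∈ S)
    {C A R C₁ C₂ : ℝ} (hR : 0 < R) (hC : ∀ x, ‖u s x‖ ≤ C / Real.sqrt (-s))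
    (hosc : ∃ c : ℝ, ∫ x in closedBall (0 : EuclideanSpace ℝ (Fin 3)) (2 * R), |p s x - c| ≤
      A / (-s) * volume.real (closedBall (0 : EuclideanSpace ℝ (Fin 3)) (2 * R)))
    (hC₁ : ∀ x, ‖fderiv ℝ (cutoff (E := EuclideanSpace ℝ (Fin 3)) R) x‖ ≤ C₁ / R)
    (hC₂ : ∀ x, |(Δ (cutoff (E := EuclideanSpace ℝ (Fin 3)) R)) x| ≤ C₂ / R ^ 2) :
    ∫ x, (1 * ((Δ (cutoff (E := EuclideanSpace ℝ (Fin 3)) R)) x * ‖u s x‖ ^ 2) +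
        fderiv ℝ (cutoff (E := EuclideanSpace ℝ (Fin 3)) R) x (u s x) * ‖u s x‖ ^ 2 +
        2 * (p s x * fderiv ℝ (cutoff (E := EuclideanSpace ℝ (Fin 3)) R) x (u s x))) ≤
      volume.real (closedBall (0 : EuclideanSpace ℝ (Fin 3)) (2 * R)) *
        (C₂ / R ^ 2 * (C / Real.sqrt (-s)) ^ 2 + C₁ / R * (C / Real.sqrt (-s)) ^ 3 +
          2 * (C₁ / R) * (C / Real.sqrt (-s)) * (A / (-s))) := by
  obtain ⟨c, hc⟩ := hosc
  set φ : EuclideanSpace ℝ (Fin 3) → ℝ := cutoff (E := EuclideanSpace ℝ (Fin 3)) R with hφdef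
  set K : Set (EuclideanSpace ℝ (Fin 3)) := closedBall (0 : EuclideanSpace ℝ (Fin 3)) (2 * R) with hKdef
  set M : ℝ := C / Real.sqrt (-s) with hMdef
  have hM0 : 0 ≤ M := (norm_nonneg _).trans (hC 0)
  have hC₁0 : 0 ≤ C₁ / R := (norm_nonneg _).trans (hC₁ 0)
  have hC₂0 : 0 ≤ C₂ / R ^ 2 := (abs_nonneg _).trans (hC₂ 0)
  have hKm : MeasurableSet K := isClosed_closedBall.measurableSet
  have hKfin : volume K < ⊤ := measure_closedBall_lt_top
  -- regularity of the slices
  have hφs : ContDiff ℝ ∞ φ := contDiff_cutoff (n := ⊤) R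
  have hφ2 : ContDiff ℝ 2 φ := hφs.of_le (by norm_cast)
  have hφ1 : ContDiff ℝ 1 φ := hφs.of_le (by norm_cast)
  have hφcs : HasCompactSupport φ := hasCompactSupport_cutoff hR
  have hΔφc : Continuous (Δ φ) := FluidPDE.continuous_laplacian hφ2
  have hDφc : Continuous (fderiv ℝ φ) := hφ1.continuous_fderiv one_ne_zero
  have huc : Continuous (u s) := (h.contDiff_velocity hs).continuous
  have hu1 : ContDiff ℝ 1 (u s) := (h.contDiff_velocity hs).of_le (by norm_cast)
  have hpc : Continuous (p s) := (h.contDiff_pressure hs).continuous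
  have hsupp : tsupport φ ⊆ K := tsupport_cutoff_subset hR
  have hΔ0 : ∀ x ∉ K, (Δ φ) x = 0 := fun x hx =>
    FluidPDE.laplacian_eq_zero_of_notMem_tsupport fun h' => hx (hsupp h')
  have hD0 : ∀ x ∉ K, fderiv ℝ φ x = 0 := fun x hx => fderiv_of_notMem_tsupport ℝ fun h' => hx (hsupp h')
  -- the three continuous, compactly supported integrands
  set f₁ : EuclideanSpace ℝ (Fin 3) → ℝ := fun x =>
    1 * ((Δ φ) x * ‖u s x‖ ^ 2) + fderiv ℝ φ x (u s x) * ‖u s x‖ ^ 2 with hf₁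
  set f₂ : EuclideanSpace ℝ (Fin 3) → ℝ := fun x => 2 * ((p s x - c) * fderiv ℝ φ x (u s x)) with hf₂
  set f₃ : EuclideanSpace ℝ (Fin 3) → ℝ := fun x => fderiv ℝ φ x (u s x) with hf₃
  have hDφu : Continuous fun x => fderiv ℝ φ x (u s x) := hDφc.clm_apply huc
  have hf₁c : Continuous f₁ :=
    (continuous_const.mul (hΔφc.mul (huc.norm.pow 2))).add (hDφu.mul (huc.norm.pow 2))
  have hf₂c : Continuous f₂ := continuous_const.mul ((hpc.sub continuous_const).mul hDφu)
  have hsupp₁ : ∀ x ∉ K, f₁ x = 0 := fun x hx => by simp only [hf₁, hΔ0 x hx, hD0 x hx]; simp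
  have hsupp₂ : ∀ x ∉ K, f₂ x = 0 := fun x hx => by simp only [hf₂, hD0 x hx]; simp
  have hsupp₃ : ∀ x ∉ K, f₃ x = 0 := fun x hx => by simp only [hf₃, hD0 x hx]; simp
  have hKc : IsCompact K := isCompact_closedBall _ _
  have hcs_of : ∀ {g : EuclideanSpace ℝ (Fin 3) → ℝ}, (∀ x ∉ K, g x = 0) → HasCompactSupport g := fun hg =>
    HasCompactSupport.of_support_subset_isCompact hKc fun x hx => by
      by_contra hxK; exact hx (hg x hxK)
  have hf₁i : Integrable f₁ := hf₁c.integrable_of_hasCompactSupport (hcs_of hsupp₁)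
  have hf₂i : Integrable f₂ := hf₂c.integrable_of_hasCompactSupport (hcs_of hsupp₂)
  have hf₃i : Integrable f₃ := hDφu.integrable_of_hasCompactSupport (hcs_of hsupp₃)
  -- the pressure constant drops out
  have hdiv0 : ∫ x, f₃ x = 0 := integral_fderiv_cutoff_apply_eq_zero (h.divFree s hs) hu1 hR
  have hsplit : ∫ x, (1 * ((Δ φ) x * ‖u s x‖ ^ 2) + fderiv ℝ φ x (u s x) * ‖u s x‖ ^ 2 +
      2 * (p s x * fderiv ℝ φ x (u s x))) = (∫ x, f₁ x) + ∫ x, f₂ x := by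
    have e : ∀ x, 1 * ((Δ φ) x * ‖u s x‖ ^ 2) + fderiv ℝ φ x (u s x) * ‖u s x‖ ^ 2 +
        2 * (p s x * fderiv ℝ φ x (u s x)) = f₁ x + f₂ x + (2 * c) * f₃ x := fun x => by
      simp only [hf₁, hf₂, hf₃]; ring
    have hi12 : Integrable (fun a => f₁ a + f₂ a) := hf₁i.add hf₂i
    have hi3 : Integrable (fun a => 2 * c * f₃ a) := hf₃i.const_mul (2 * c)
    have h3 : ∫ a, 2 * c * f₃ a = 0 := by rw [integral_const_mul, hdiv0, mul_zero]
    rw [integral_congr_ae (Eventually.of_forall e), integral_add hi12 hi3,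
      integral_add hf₁i hf₂i, h3, add_zero]
  rw [hsplit]
  -- pointwise bounds on `K`
  have hu2 : ∀ x, ‖u s x‖ ^ 2 ≤ M ^ 2 := fun x => pow_le_pow_left₀ (norm_nonneg _) (hC x) 2
  have hu3 : ∀ x, ‖u s x‖ ^ 3 ≤ M ^ 3 := fun x => pow_le_pow_left₀ (norm_nonneg _) (hC x) 3
  have hDu : ∀ x, |fderiv ℝ φ x (u s x)| ≤ C₁ / R * ‖u s x‖ := fun x => by
    rw [← Real.norm_eq_abs]
    exact (ContinuousLinearMap.le_opNorm _ _).trans (mul_le_mul_of_nonneg_right (hC₁ x) (norm_nonneg _))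
  have hb₁ : ∀ x, f₁ x ≤ C₂ / R ^ 2 * M ^ 2 + C₁ / R * M ^ 3 := by
    intro x
    have h1 : 1 * ((Δ φ) x * ‖u s x‖ ^ 2) ≤ C₂ / R ^ 2 * M ^ 2 := by
      rw [one_mul]
      calc (Δ φ) x * ‖u s x‖ ^ 2 ≤ |(Δ φ) x| * ‖u s x‖ ^ 2 :=
            mul_le_mul_of_nonneg_right (le_abs_self _) (sq_nonneg _)
        _ ≤ C₂ / R ^ 2 * M ^ 2 := mul_le_mul (hC₂ x) (hu2 x) (sq_nonneg _) hC₂0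
    have h2 : fderiv ℝ φ x (u s x) * ‖u s x‖ ^ 2 ≤ C₁ / R * M ^ 3 := by
      calc fderiv ℝ φ x (u s x) * ‖u s x‖ ^ 2 ≤ |fderiv ℝ φ x (u s x)| * ‖u s x‖ ^ 2 :=
            mul_le_mul_of_nonneg_right (le_abs_self _) (sq_nonneg _)
        _ ≤ (C₁ / R * ‖u s x‖) * ‖u s x‖ ^ 2 := mul_le_mul_of_nonneg_right (hDu x) (sq_nonneg _)
        _ = C₁ / R * ‖u s x‖ ^ 3 := by ring
        _ ≤ C₁ / R * M ^ 3 := mul_le_mul_of_nonneg_left (hu3 x) hC₁0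
    simp only [hf₁]
    linarith
  have hb₂ : ∀ x, f₂ x ≤ 2 * (C₁ / R) * M * |p s x - c| := by
    intro x
    have h1 : (p s x - c) * fderiv ℝ φ x (u s x) ≤ |p s x - c| * (C₁ / R * M) := by
      calc (p s x - c) * fderiv ℝ φ x (u s x) ≤ |(p s x - c) * fderiv ℝ φ x (u s x)| := le_abs_self _
        _ = |p s x - c| * |fderiv ℝ φ x (u s x)| := abs_mul _ _
        _ ≤ |p s x - c| * (C₁ / R * ‖u s x‖) := mul_le_mul_of_nonneg_left (hDu x) (abs_nonneg _)
        _ ≤ |p s x - c| * (C₁ / R * M) :=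
            mul_le_mul_of_nonneg_left (mul_le_mul_of_nonneg_left (hC x) hC₁0) (abs_nonneg _)
    simp only [hf₂]
    nlinarith [h1]
  -- integrate over `K`
  have hI₁ : ∫ x, f₁ x ≤ volume.real K * (C₂ / R ^ 2 * M ^ 2 + C₁ / R * M ^ 3) := by
    rw [← setIntegral_eq_integral_of_forall_compl_eq_zero (s := K) (fun x hx => hsupp₁ x hx)]
    calc ∫ x in K, f₁ x ≤ ∫ x in K, (C₂ / R ^ 2 * M ^ 2 + C₁ / R * M ^ 3) :=
          setIntegral_mono_on hf₁i.integrableOn (integrableOn_const hKfin.ne) hKm fun x _ => hb₁ x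
      _ = volume.real K * (C₂ / R ^ 2 * M ^ 2 + C₁ / R * M ^ 3) := by
          rw [setIntegral_const, smul_eq_mul]
  have hpi : IntegrableOn (fun x => |p s x - c|) K volume :=
    ((hpc.sub continuous_const).abs.continuousOn).integrableOn_compact hKc
  have hI₂ : ∫ x, f₂ x ≤ 2 * (C₁ / R) * M * (A / (-s) * volume.real K) := by
    rw [← setIntegral_eq_integral_of_forall_compl_eq_zero (s := K) (fun x hx => hsupp₂ x hx)]
    calc ∫ x in K, f₂ x ≤ ∫ x in K, 2 * (C₁ / R) * M * |p s x - c| :=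
          setIntegral_mono_on hf₂i.integrableOn (hpi.const_mul _) hKm fun x _ => hb₂ x
      _ = 2 * (C₁ / R) * M * ∫ x in K, |p s x - c| := integral_const_mul _ _
      _ ≤ 2 * (C₁ / R) * M * (A / (-s) * volume.real K) :=
          mul_le_mul_of_nonneg_left hc (by positivity)
  have hV0 : 0 ≤ volume.real K := measureReal_nonneg
  calc (∫ x, f₁ x) + ∫ x, f₂ x
      ≤ volume.real K * (C₂ / R ^ 2 * M ^ 2 + C₁ / R * M ^ 3) + 2 * (C₁ / R) * M * (A / (-s) * volume.real K) :=
        add_le_add hI₁ hI₂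
    _ = volume.real K * (C₂ / R ^ 2 * M ^ 2 + C₁ / R * M ^ 3 + 2 * (C₁ / R) * M * (A / (-s))) := by ring

/-! ### The two ends of the energy identity -/

/-- The cut-off energy of a slice with `‖u(t,·)‖ ≤ C/√(−t)`: `∫ φ|u(t)|² ≤ |B̄(0,2R)| · (C/√(−t))²`. -/
theorem integral_cutoff_norm_sq_le {w : EuclideanSpace ℝ (Fin 3) → EuclideanSpace ℝ (Fin 3)} (hw : Continuous w)
    {R B : ℝ} (hR : 0 < R) (hB : ∀ x, ‖w x‖ ≤ B) :
    ∫ x, cutoff (E := EuclideanSpace ℝ (Fin 3)) R x * ‖w x‖ ^ 2 ≤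
      volume.real (closedBall (0 : EuclideanSpace ℝ (Fin 3)) (2 * R)) * B ^ 2 := by
  set K : Set (EuclideanSpace ℝ (Fin 3)) := closedBall (0 : EuclideanSpace ℝ (Fin 3)) (2 * R) with hKdef
  have hKm : MeasurableSet K := isClosed_closedBall.measurableSet
  have hKfin : volume K < ⊤ := measure_closedBall_lt_top
  have hKc : IsCompact K := isCompact_closedBall _ _
  have hsupp : ∀ x ∉ K, cutoff (E := EuclideanSpace ℝ (Fin 3)) R x * ‖w x‖ ^ 2 = 0 := fun x hx => by
    rw [image_eq_zero_of_notMem_tsupport (fun h' => hx (tsupport_cutoff_subset hR h')), zero_mul]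
  have hfc : Continuous fun x => cutoff (E := EuclideanSpace ℝ (Fin 3)) R x * ‖w x‖ ^ 2 :=
    (contDiff_cutoff (n := 0) R).continuous.mul (hw.norm.pow 2)
  have hfi : Integrable fun x => cutoff (E := EuclideanSpace ℝ (Fin 3)) R x * ‖w x‖ ^ 2 :=
    hfc.integrable_of_hasCompactSupport (HasCompactSupport.of_support_subset_isCompact hKc fun x hx => by
      by_contra hxK; exact hx (hsupp x hxK))
  rw [← setIntegral_eq_integral_of_forall_compl_eq_zero (s := K) (fun x hx => hsupp x hx)]
  calc ∫ x in K, cutoff (E := EuclideanSpace ℝ (Fin 3)) R x * ‖w x‖ ^ 2 ≤ ∫ x in K, B ^ 2 := by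
        refine setIntegral_mono_on hfi.integrableOn (integrableOn_const hKfin.ne) hKm fun x _ => ?_
        calc cutoff (E := EuclideanSpace ℝ (Fin 3)) R x * ‖w x‖ ^ 2 ≤ 1 * ‖w x‖ ^ 2 :=
              mul_le_mul_of_nonneg_right (cutoff_le_one R x) (sq_nonneg _)
          _ ≤ B ^ 2 := by rw [one_mul]; exact pow_le_pow_left₀ (norm_nonneg _) (hB x) 2
    _ = volume.real K * B ^ 2 := by rw [setIntegral_const, smul_eq_mul]

/-- The energy on the ball `B(0,R)` is at most the cut-off energy: `∫_{B(0,R)} |w|² ≤ ∫ φ |w|²` (`φ = 1` on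
`B̄(0,R)`, `φ ≥ 0`). -/
theorem setIntegral_ball_le_integral_cutoff {w : EuclideanSpace ℝ (Fin 3) → EuclideanSpace ℝ (Fin 3)}
    (hw : Continuous w) {R : ℝ} (hR : 0 < R) :
    ∫ x in ball (0 : EuclideanSpace ℝ (Fin 3)) R, ‖w x‖ ^ 2 ≤
      ∫ x, cutoff (E := EuclideanSpace ℝ (Fin 3)) R x * ‖w x‖ ^ 2 := by
  have hKc : IsCompact (closedBall (0 : EuclideanSpace ℝ (Fin 3)) (2 * R)) := isCompact_closedBall _ _
  have hsupp : ∀ x ∉ closedBall (0 : EuclideanSpace ℝ (Fin 3)) (2 * R),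
      cutoff (E := EuclideanSpace ℝ (Fin 3)) R x * ‖w x‖ ^ 2 = 0 := fun x hx => by
    rw [image_eq_zero_of_notMem_tsupport (fun h' => hx (tsupport_cutoff_subset hR h')), zero_mul]
  have hfc : Continuous fun x => cutoff (E := EuclideanSpace ℝ (Fin 3)) R x * ‖w x‖ ^ 2 :=
    (contDiff_cutoff (n := 0) R).continuous.mul (hw.norm.pow 2)
  have hfi : Integrable fun x => cutoff (E := EuclideanSpace ℝ (Fin 3)) R x * ‖w x‖ ^ 2 :=
    hfc.integrable_of_hasCompactSupport (HasCompactSupport.of_support_subset_isCompact hKc fun x hx => by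
      by_contra hxK; exact hx (hsupp x hxK))
  have h1 : ∫ x in ball (0 : EuclideanSpace ℝ (Fin 3)) R, ‖w x‖ ^ 2 =
      ∫ x in ball (0 : EuclideanSpace ℝ (Fin 3)) R, cutoff (E := EuclideanSpace ℝ (Fin 3)) R x * ‖w x‖ ^ 2 := by
    refine setIntegral_congr_fun measurableSet_ball fun x hx => ?_
    rw [mem_ball, dist_zero_right] at hx
    rw [cutoff_eq_one hR hx.le, one_mul]
  rw [h1]
  exact setIntegral_le_integral hfi (Eventually.of_forall fun x =>
    mul_nonneg (cutoff_nonneg R x) (sq_nonneg _))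

/-! ### Two elementary time integrals -/

/-- `∫_{t₁}^{t₂} ds/(−s) = log(t₁/t₂)` for `t₁ ≤ t₂ < 0`. -/
theorem intervalIntegral_inv_neg {t₁ t₂ : ℝ} (h12 : t₁ ≤ t₂) (h2 : t₂ < 0) :
    ∫ s in t₁..t₂, 1 / (-s) = Real.log (t₁ / t₂) := by
  have hderiv : ∀ s ∈ uIcc t₁ t₂, HasDerivAt (fun σ : ℝ => -Real.log (-σ)) (1 / (-s)) s := by
    intro s hs
    rw [uIcc_of_le h12] at hs
    have hs0 : s < 0 := lt_of_le_of_lt hs.2 h2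
    have h1 : HasDerivAt (fun σ : ℝ => -σ) (-1) s := hasDerivAt_neg s
    have h2' := (h1.log (neg_pos.2 hs0).ne').neg
    refine h2'.congr_deriv ?_
    field_simp
  have hcont : ContinuousOn (fun s : ℝ => 1 / (-s)) (uIcc t₁ t₂) := by
    refine continuousOn_const.div (continuousOn_id.neg) fun s hs => ?_
    rw [uIcc_of_le h12] at hs
    have : s < 0 := lt_of_le_of_lt hs.2 h2
    linarith
  rw [intervalIntegral.integral_eq_sub_of_hasDerivAt hderiv (hcont.intervalIntegrable)]
  have h1 : 0 < -t₁ := by linarith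
  have h2' : 0 < -t₂ := by linarith
  rw [show t₁ / t₂ = (-t₁) / (-t₂) by rw [neg_div_neg_eq], Real.log_div h1.ne' h2'.ne']
  ring

/-- `∫_{t₁}^{t₂} ds/((−s)√(−s)) ≤ 2/√(−t₂)` for `t₁ ≤ t₂ < 0` (the value is `2/√(−t₂) − 2/√(−t₁)`). -/
theorem intervalIntegral_inv_neg_sqrt_le {t₁ t₂ : ℝ} (h12 : t₁ ≤ t₂) (h2 : t₂ < 0) :
    ∫ s in t₁..t₂, 1 / (-s * Real.sqrt (-s)) ≤ 2 / Real.sqrt (-t₂) := by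
  have hderiv : ∀ s ∈ uIcc t₁ t₂, HasDerivAt (fun σ : ℝ => 2 / Real.sqrt (-σ)) (1 / (-s * Real.sqrt (-s))) s := by
    intro s hs
    rw [uIcc_of_le h12] at hs
    have hs0 : 0 < -s := by linarith [lt_of_le_of_lt hs.2 h2]
    have hsq : 0 < Real.sqrt (-s) := Real.sqrt_pos.2 hs0
    have h1 : HasDerivAt (fun σ : ℝ => Real.sqrt (-σ)) (-1 / (2 * Real.sqrt (-s))) s := by
      have h := (hasDerivAt_neg s).sqrt hs0.ne'
      refine h.congr_deriv ?_
      ring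
    have h2' := (hasDerivAt_const s (2 : ℝ)).div h1 hsq.ne'
    refine h2'.congr_deriv ?_
    have hss : Real.sqrt (-s) ^ 2 = -s := Real.sq_sqrt hs0.le
    rw [hss]
    field_simp
    ring
  have hcont : ContinuousOn (fun s : ℝ => 1 / (-s * Real.sqrt (-s))) (uIcc t₁ t₂) := by
    refine continuousOn_const.div (continuousOn_id.neg.mul (continuousOn_id.neg.sqrt)) fun s hs => ?_
    rw [uIcc_of_le h12] at hs
    have hs0 : 0 < -s := by linarith [lt_of_le_of_lt hs.2 h2]
    exact (mul_pos hs0 (Real.sqrt_pos.2 hs0)).ne'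
  rw [intervalIntegral.integral_eq_sub_of_hasDerivAt hderiv (hcont.intervalIntegrable)]
  have : 0 ≤ 2 / Real.sqrt (-t₁) := by positivity
  linarith

end Summit.NavierStokesRegularity.NavierStokesRegularity.Theorems.PoloidalWindowDoorPoloidalWindowRigidityLargeScaleEnergyDecayTools

end
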